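import Summits.ResolutionOfSingularities.ResolutionOfSingularities.Theorems.FrobeniusLadderFInjectiveMacaulayficationE8LineDeformedData
import Mathlib.RingTheory.Polynomial.Eisenstein.Criterion
import HarnessLib

/-!
# The cusp-degenerate E8-line `g = s³ + (s−1)(z̃² + e²w̃⁵)`: `(g)` is prime and no variable lies in `(g)` (crux `FInjectiveMacaulayfication`, hole #3)

Support file for crux stmt-ResolutionOfSingularities-15315 (`FrobeniusLadder.FInjectiveMacaulayfication`), chain w45a, hole #3;
SCOPING MEMO `L/res-L1-w45a-stub-2/SCOPING-fcusp-F3.md` §3/§6(i) (res-L1-w45a-stub-2). Variables `(e, s, w̃, z̃) = (X 0, X 1, X 2, X 3)`.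
`(g)` IS PRIME over every field: along `k[X₀,…,X₃] ≃ k[Y₀,Y₁,Y₂][T]` (`s ↦ T`, `e ↦ Y₀`, `w̃ ↦ Y₁`, `z̃ ↦ Y₂`) `g` is the MONIC CUBIC
`T³ + q·T − q`, `q = Y₂² + Y₀²Y₁⁵`, and `q` is prime (monic quadratic in `Y₂`, `−Y₀²Y₁⁵` not a square by the odd-degree test), so
EISENSTEIN at `(q)` applies (`Polynomial.irreducible_of_eisenstein_criterion`). No variable is divisible by `g` (evaluation tests).
[OURS · L1 W4.5a] AI-written; AI review is weaker than expert review. No statement of Hironaka2017 is used; no external fact.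
No definitions, no named facts. [folklore]
-/

set_option linter.dupNamespace false

noncomputable section

open Polynomial

namespace Summit.ResolutionOfSingularities.ResolutionOfSingularities.Theorems.FInjectiveMacaulayfication.CuspE8LinePrime

open Summit.ResolutionOfSingularities.ResolutionOfSingularities.Theorems.FInjectiveMacaulayfication

variable {k : Type} [Field k]

/-- `q = Y₂² + Y₀²Y₁⁵` is prime in `k[Y₀,Y₁,Y₂]` (monic quadratic in `Y₂`; `−Y₀²Y₁⁵ ↦ −X⁵` under `Y₀ ↦ 1, Y₁ ↦ X` is not a square).
[folklore] -/
theorem prime_q : Prime (MvPolynomial.X 2 ^ 2 + MvPolynomial.X 0 ^ 2 * MvPolynomial.X 1 ^ 5 : MvPolynomial (Fin 3) k) := by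
  obtain ⟨e, he0, he1, he2⟩ : ∃ e : MvPolynomial (Fin 3) k ≃+* (MvPolynomial (Fin 2) k)[X],
      e (MvPolynomial.X 0) = C (MvPolynomial.X 1) ∧ e (MvPolynomial.X 1) = C (MvPolynomial.X 0) ∧
        e (MvPolynomial.X 2) = Polynomial.X := by
    refine ⟨((MvPolynomial.renameEquiv k (Equiv.swap (0 : Fin 3) 2)).trans (MvPolynomial.finSuccEquiv k 2)).toRingEquiv,
      ?_, ?_, ?_⟩
    · show MvPolynomial.finSuccEquiv k 2 (MvPolynomial.rename (Equiv.swap (0 : Fin 3) 2) (MvPolynomial.X 0)) = _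
      rw [MvPolynomial.rename_X, Equiv.swap_apply_left]
      exact MvPolynomial.finSuccEquiv_X_succ (j := 1)
    · show MvPolynomial.finSuccEquiv k 2 (MvPolynomial.rename (Equiv.swap (0 : Fin 3) 2) (MvPolynomial.X 1)) = _
      rw [MvPolynomial.rename_X, Equiv.swap_apply_of_ne_of_ne (by decide) (by decide)]
      exact MvPolynomial.finSuccEquiv_X_succ (j := 0)
    · show MvPolynomial.finSuccEquiv k 2 (MvPolynomial.rename (Equiv.swap (0 : Fin 3) 2) (MvPolynomial.X 2)) = _
      rw [MvPolynomial.rename_X, Equiv.swap_apply_right]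
      exact MvPolynomial.finSuccEquiv_X_zero
  have heq : e (MvPolynomial.X 2 ^ 2 + MvPolynomial.X 0 ^ 2 * MvPolynomial.X 1 ^ 5) =
      X ^ 2 + C (MvPolynomial.X 1 ^ 2 * MvPolynomial.X 0 ^ 5) := by
    simp only [map_add, map_mul, map_pow, he0, he1, he2]
  have hc : ∀ a : MvPolynomial (Fin 2) k, a * a ≠ -(MvPolynomial.X 1 ^ 2 * MvPolynomial.X 0 ^ 5) :=
    E8Forms.mul_self_ne_neg_of_aeval ![-Polynomial.X, 1] 2 (by
      simp only [map_mul, map_pow, MvPolynomial.aeval_X, Matrix.cons_val_zero, Matrix.cons_val_one]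
      ring)
  exact (E8Forms.prime_and_not_dvd_of_ringEquiv e _ _ heq hc).1

/-- The chart `k[X₀,…,X₃] ≃ k[Y₀,Y₁,Y₂][T]`, `X 1 ↦ T`, `X 0 ↦ C Y₀`, `X 2 ↦ C Y₁`, `X 3 ↦ C Y₂`. [folklore] -/
theorem exists_equiv : ∃ e : MvPolynomial (Fin 4) k ≃+* (MvPolynomial (Fin 3) k)[X],
    e (MvPolynomial.X 0) = C (MvPolynomial.X 0) ∧ e (MvPolynomial.X 1) = Polynomial.X ∧
      e (MvPolynomial.X 2) = C (MvPolynomial.X 1) ∧ e (MvPolynomial.X 3) = C (MvPolynomial.X 2) := by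
  refine ⟨((MvPolynomial.renameEquiv k (Equiv.swap (0 : Fin 4) 1)).trans (MvPolynomial.finSuccEquiv k 3)).toRingEquiv,
    ?_, ?_, ?_, ?_⟩
  · show MvPolynomial.finSuccEquiv k 3 (MvPolynomial.rename (Equiv.swap (0 : Fin 4) 1) (MvPolynomial.X 0)) = _
    rw [MvPolynomial.rename_X, Equiv.swap_apply_left]
    exact MvPolynomial.finSuccEquiv_X_succ (j := 0)
  · show MvPolynomial.finSuccEquiv k 3 (MvPolynomial.rename (Equiv.swap (0 : Fin 4) 1) (MvPolynomial.X 1)) = _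
    rw [MvPolynomial.rename_X, Equiv.swap_apply_right]
    exact MvPolynomial.finSuccEquiv_X_zero
  · show MvPolynomial.finSuccEquiv k 3 (MvPolynomial.rename (Equiv.swap (0 : Fin 4) 1) (MvPolynomial.X 2)) = _
    rw [MvPolynomial.rename_X, Equiv.swap_apply_of_ne_of_ne (by decide) (by decide)]
    exact MvPolynomial.finSuccEquiv_X_succ (j := 1)
  · show MvPolynomial.finSuccEquiv k 3 (MvPolynomial.rename (Equiv.swap (0 : Fin 4) 1) (MvPolynomial.X 3)) = _
    rw [MvPolynomial.rename_X, Equiv.swap_apply_of_ne_of_ne (by decide) (by decide)]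
    exact MvPolynomial.finSuccEquiv_X_succ (j := 2)

/-- **`g = s³ + q·s − q` is irreducible as a monic cubic over `k[Y₀,Y₁,Y₂]`** — Eisenstein at the prime `q`. [folklore] -/
theorem irreducible_cubic (q : MvPolynomial (Fin 3) k) (hq : Prime q) :
    Irreducible (X ^ 3 + C q * X - C q : (MvPolynomial (Fin 3) k)[X]) := by
  have hmonic : (X ^ 3 + C q * X - C q : (MvPolynomial (Fin 3) k)[X]).Monic := by
    have h : (X ^ 3 + C q * X - C q : (MvPolynomial (Fin 3) k)[X]) = X ^ 3 + (C q * X - C q) := by ring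
    rw [h]
    refine (monic_X_pow 3).add_of_left (lt_of_le_of_lt (degree_sub_le _ _) ?_)
    rw [degree_X_pow]
    refine max_lt ((degree_C_mul_X_le q).trans_lt (by exact_mod_cast (by norm_num : (1 : ℕ) < 3))) ?_
    exact (degree_C_le).trans_lt (by exact_mod_cast (by norm_num : (0 : ℕ) < 3))
  have h1 : (X ^ 3 + C q * X : (MvPolynomial (Fin 3) k)[X]).natDegree = 3 := by
    rw [natDegree_add_eq_left_of_natDegree_lt] <;> rw [natDegree_X_pow]
    exact (natDegree_le_of_degree_le (degree_C_mul_X_le q)).trans_lt (by norm_num)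
  have hdeg : (X ^ 3 + C q * X - C q : (MvPolynomial (Fin 3) k)[X]).natDegree = 3 := by
    rw [natDegree_sub_eq_left_of_natDegree_lt] <;> rw [h1]
    rw [natDegree_C]; norm_num
  haveI hP : (Ideal.span {q}).IsPrime := (Ideal.span_singleton_prime hq.ne_zero).mpr hq
  refine Polynomial.irreducible_of_eisenstein_criterion hP ?_ ?_ ?_ ?_ hmonic.isPrimitive
  · rw [hmonic.leadingCoeff]
    exact (Ideal.ne_top_iff_one _).mp hP.ne_top
  · intro n hn
    rw [degree_eq_natDegree hmonic.ne_zero, hdeg] at hn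
    have hn' : n < 3 := by exact_mod_cast hn
    interval_cases n
    · simp only [coeff_sub, coeff_add, coeff_X_pow, coeff_C_mul_X, coeff_C_zero]
      norm_num [Ideal.mem_span_singleton_self]
    · simp only [coeff_sub, coeff_add, coeff_X_pow, coeff_C_mul_X, coeff_C]
      norm_num [Ideal.mem_span_singleton_self]
    · simp only [coeff_sub, coeff_add, coeff_X_pow, coeff_C_mul_X, coeff_C]
      norm_num
  · rw [degree_eq_natDegree hmonic.ne_zero, hdeg]
    exact_mod_cast (by norm_num : (0:ℕ) < 3)
  · rw [Ideal.span_singleton_pow]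
    simp only [coeff_sub, coeff_add, coeff_X_pow, coeff_C_mul_X, coeff_C_zero]
    norm_num
    intro h
    obtain ⟨r, hr⟩ := Ideal.mem_span_singleton.mp (by simpa [Ideal.neg_mem_iff] using h)
    have h1 : q * (q * r) = q * 1 := by rw [mul_one, ← mul_assoc, ← pow_two]; exact hr.symm
    exact hq.not_unit (IsUnit.of_mul_eq_one r (mul_left_cancel₀ hq.ne_zero h1))

/-- **`(g)` IS PRIME in `k[e,s,w̃,z̃]`, every field**, and no variable lies in `(g)`. [folklore] -/
theorem isPrime_span_g (g : MvPolynomial (Fin 4) k)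
    (hg : g = MvPolynomial.X 1 ^ 3 + (MvPolynomial.X 1 - 1) * (MvPolynomial.X 3 ^ 2 + MvPolynomial.X 0 ^ 2 * MvPolynomial.X 2 ^ 5)) :
    (Ideal.span {g}).IsPrime ∧ ∀ i : Fin 4, MvPolynomial.X i ∉ Ideal.span {g} := by
  obtain ⟨e, he0, he1, he2, he3⟩ := exists_equiv (k := k)
  have heg : e g = X ^ 3 + C (MvPolynomial.X 2 ^ 2 + MvPolynomial.X 0 ^ 2 * MvPolynomial.X 1 ^ 5) * X -
      C (MvPolynomial.X 2 ^ 2 + MvPolynomial.X 0 ^ 2 * MvPolynomial.X 1 ^ 5) := by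
    rw [hg]
    simp only [map_add, map_sub, map_mul, map_pow, map_one, he0, he1, he2, he3]
    ring
  have hirr : Irreducible (e g) := heg ▸ irreducible_cubic _ prime_q
  have hprime : Prime g := (MulEquiv.prime_iff e.toMulEquiv).mp hirr.prime
  have hP : (Ideal.span {g}).IsPrime := (Ideal.span_singleton_prime hprime.ne_zero).mpr hprime
  refine ⟨hP, fun i => PrimeTransfer.X_not_mem_span_of_isPrime hP ?_⟩
  fin_cases i
  · refine ThreefoldNotDvd.not_mem_span_X_of_eval_eq_one 0 ![0, 1, 0, 0] rfl ?_
    subst hg; simp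
  · refine ThreefoldIdentities.not_mem_span_singleton_of_map (MvPolynomial.eval (![1, 0, 1, 0] : Fin 4 → k))
      (by rw [MvPolynomial.eval_X]; rfl) ?_
    subst hg; simp
  · refine ThreefoldNotDvd.not_mem_span_X_of_eval_eq_one 2 ![0, 1, 0, 0] rfl ?_
    subst hg; simp
  · refine ThreefoldNotDvd.not_mem_span_X_of_eval_eq_one 3 ![0, 1, 0, 0] rfl ?_
    subst hg; simp

/-- `x̄_v ≠ 0` in `k[X]/(g)` for every variable. [folklore] -/
theorem X_ne_zero (g : MvPolynomial (Fin 4) k)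
    (hg : g = MvPolynomial.X 1 ^ 3 + (MvPolynomial.X 1 - 1) * (MvPolynomial.X 3 ^ 2 + MvPolynomial.X 0 ^ 2 * MvPolynomial.X 2 ^ 5))
    (v : Fin 4) : Ideal.Quotient.mk (Ideal.span {g}) (MvPolynomial.X v) ≠ 0 := fun h =>
  (isPrime_span_g g hg).2 v (Ideal.Quotient.eq_zero_iff_mem.mp h)

end Summit.ResolutionOfSingularities.ResolutionOfSingularities.Theorems.FInjectiveMacaulayfication.CuspE8LinePrime

end
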